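import Summits.QuantumFields.YangMills.Theorems.QuantileBitPuritySectors
import Summits.QuantumFields.YangMills.Theorems.ToronSmallBallPairedTranslate
import HarnessLib

/-!
# Translates INSIDE one seam sector: domination of a sector event by its images under measure-preserving chain maps (possibly depending on the seam
# field), the ± paired form, and translate counting — the entry point of the periodic-sector core estimate

Support module (`--supports` stmt-QuantumFields-23948; memo HOME `bc/g14-dw/PLAN-PERIODIC.md` §B, skeleton `HolonomyQuantileSubQuartic_periodic_skeleton.lean`,
stub `PeriodicCoreEstimate`).  The sector weight `TT.sectorWeight β n z F` is the integral of `w_z · F` against the product of the slice a-priori measure and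
the seam-field Haar measure, `w_z(U⃗, g) = ∏_{i<n} K_β(U_i,U_{i+1}) · K_β(U_n, g·tw_z U_0) ≥ 0` (`TT.sectorWeight_eq_integral_prod`).  A sheet translate of
PLAN-X1 v2 is a map of the slices `U⃗ ↦ Φ_g U⃗` which may depend on the seam field `g` (case (β): the axis of the Gauss variable) and preserves the
slice measure for every `g`; on the product space it is the skew map `(g, U⃗) ↦ (g, Φ_g U⃗)`, measure preserving by Fubini (Mathlib `MeasurePreserving.skew_product`).
So the tree's abstract translate lemmas (`Translate.setIntegral_le_of_map`, `setIntegral_le_of_paired_maps`, `mul_setIntegral_le_of_disjoint`, p690859) give: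

* §1 `sectorWeight_indicator_eq_setIntegral` — a sector event's weight as a set integral of `w_z` on `(seam field) × (slices)`;
  `measurePreserving_skew` — `(g, U⃗) ↦ (g, Φ_g U⃗)` preserves the product measure;
* §2 ★ `sectorWeight_indicator_le_of_translate` — ONE translate: if `Φ_g` preserves the slice measure for every `g`, maps the event `A` into `B`, and the
  sector density obeys `w_z ≤ C · w_z ∘ Φ` on `A`, then `sectorWeight 𝟙_A ≤ C · sectorWeight 𝟙_B`;  ★ `sectorWeight_indicator_le_of_paired_translates` — the
  `±` PAIR form (`2 w_z ≤ C (w_z∘Φ₊ + w_z∘Φ₋)` on `A`: the odd part of the cost is free);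
* §3 ★ `mul_sectorWeight_indicator_le_of_disjoint` — COUNTING: `K` such dominations into pairwise disjoint events give `K · sectorWeight 𝟙_A ≤ C · sectorWeight 1`,
  i.e. the stub's shape `sectorWeight 0 𝟙_A ≤ (C/K) · sectorWeight 0 1`.

Events are measurable subsets of `(Site → SU2) × (Fin (n+1) → GaugeConfig)` (seam field first), so GOOD events constraining the seam pair are allowed.
HONEST FRAMING: measure-theoretic bookkeeping; no estimate of any cost is made here; nothing about infinite volume, the continuum limit or the Clay gap.
No `sorry`, no new axiom, no new definition.  References: [cite: Luscher1983, §2]; [cite: MadrasSokal1988, §2].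
-/

set_option autoImplicit false

noncomputable section

open MeasureTheory Filter Topology Real Function Set
open scoped BigOperators
open Literature.MathematicalPhysics.QuantumLattice
open Literature.MathematicalPhysics.QuantumFieldTheory hiding SU2
open Summit.QuantumFields.YangMills.Theorems

namespace Summit.QuantumFields.YangMills.Theorems.FemtoTransferGap.TT

open Summit.QuantumFields.YangMills.Theorems.FemtoTransferGap
open Summit.QuantumFields.YangMills.Theorems.FemtoTransferGap.Translate

variable {L : ℕ} [NeZero L]

/-! ## §1 Sector events as set integrals on `(seam field) × (slices)`; skew maps -/

/-- The sector density `w_z(U⃗, g)` is non-negative. [folklore] -/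
theorem seamDensity_nonneg (β : ℝ) (n : ℕ) (z : Fin 3 → Bool) (p : (Site 3 L → SU2) × (Fin (n + 1) → GaugeConfig 3 L SU2)) :
    0 ≤ (∏ i : Fin n, transferKernel su2Rep β (p.2 i.castSucc) (p.2 i.succ)) *
        transferKernel su2Rep β (p.2 (Fin.last n)) (gaugeTransform p.1 (twist3 z (p.2 0))) :=
  seamChain_nonneg β n z p.2 p.1

/-- The sector density is integrable on `(seam field) × (slices)`. [folklore] -/
theorem integrable_seamDensity_swap (β : ℝ) (n : ℕ) (z : Fin 3 → Bool) :
    Integrable (fun p : (Site 3 L → SU2) × (Fin (n + 1) → GaugeConfig 3 L SU2) =>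
        (∏ i : Fin n, transferKernel su2Rep β (p.2 i.castSucc) (p.2 i.succ)) *
          transferKernel su2Rep β (p.2 (Fin.last n)) (gaugeTransform p.1 (twist3 z (p.2 0))))
      ((gaugeMeasure L).prod (Measure.pi fun _ : Fin (n + 1) => configMeasure SU2 L)) := by
  haveI := isProbabilityMeasure_gaugeMeasure (L := L)
  have h := integrable_sectorIntegrand (L := L) β n z (F := fun _ _ => (1 : ℝ)) measurable_const (C := 1) (fun _ _ => by simp)
  have h1 : Integrable (fun q : (Fin (n + 1) → GaugeConfig 3 L SU2) × (Site 3 L → SU2) =>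
      (∏ i : Fin n, transferKernel su2Rep β (q.1 i.castSucc) (q.1 i.succ)) *
        transferKernel su2Rep β (q.1 (Fin.last n)) (gaugeTransform q.2 (twist3 z (q.1 0))))
      ((Measure.pi fun _ : Fin (n + 1) => configMeasure SU2 L).prod (gaugeMeasure L)) := by
    refine h.congr (ae_of_all _ fun q => ?_)
    simp only [uncurry, mul_one]
  exact h1.swap

/-- **A sector event's weight as a set integral**: for a measurable `A ⊆ (seam field) × (slices)`,
`sectorWeight β n z 𝟙_A = ∫_A w_z d(Haar ⊗ slices)`. [cite: MontvayMunster1994, (3.145)] -/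
theorem sectorWeight_indicator_eq_setIntegral (β : ℝ) (n : ℕ) (z : Fin 3 → Bool)
    {A : Set ((Site 3 L → SU2) × (Fin (n + 1) → GaugeConfig 3 L SU2))} (hA : MeasurableSet A) :
    sectorWeight β n z (fun Us g => A.indicator (fun _ => (1 : ℝ)) (g, Us)) =
      ∫ p in A, (∏ i : Fin n, transferKernel su2Rep β (p.2 i.castSucc) (p.2 i.succ)) *
        transferKernel su2Rep β (p.2 (Fin.last n)) (gaugeTransform p.1 (twist3 z (p.2 0)))
        ∂((gaugeMeasure L).prod (Measure.pi fun _ : Fin (n + 1) => configMeasure SU2 L)) := by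
  haveI := isProbabilityMeasure_gaugeMeasure (L := L)
  have hF : Measurable (uncurry fun (Us : Fin (n + 1) → GaugeConfig 3 L SU2) (g : Site 3 L → SU2) => A.indicator (fun _ => (1 : ℝ)) (g, Us)) :=
    (measurable_const.indicator hA).comp (measurable_snd.prodMk measurable_fst)
  rw [sectorWeight_eq_integral_prod β n z hF (fun Us g => abs_indicator_one_le A (g, Us)),
    ← integral_prod_swap, ← integral_indicator hA]
  refine integral_congr_ae (ae_of_all _ fun p => ?_)
  simp only [Prod.swap]
  by_cases hp : p ∈ A
  · rw [Set.indicator_of_mem hp, Set.indicator_of_mem hp, mul_one]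
  · rw [Set.indicator_of_notMem hp, Set.indicator_of_notMem hp, mul_zero]

/-- The total sector weight as the integral of the density on `(seam field) × (slices)`. [cite: MontvayMunster1994, (3.145)] -/
theorem sectorWeight_one_eq_integral_swap (β : ℝ) (n : ℕ) (z : Fin 3 → Bool) :
    sectorWeight (L := L) β n z (fun _ _ => (1 : ℝ)) =
      ∫ p, (∏ i : Fin n, transferKernel su2Rep β (p.2 i.castSucc) (p.2 i.succ)) *
        transferKernel su2Rep β (p.2 (Fin.last n)) (gaugeTransform p.1 (twist3 z (p.2 0)))
        ∂((gaugeMeasure L).prod (Measure.pi fun _ : Fin (n + 1) => configMeasure SU2 L)) := by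
  have h := sectorWeight_indicator_eq_setIntegral (L := L) β n z (A := Set.univ) MeasurableSet.univ
  simp only [Set.indicator_univ, Measure.restrict_univ] at h
  exact h

/-- **Skew translates preserve the product measure**: if `Φ_g` preserves the slice measure for every seam field `g` (and `(g, U⃗) ↦ Φ_g U⃗` is jointly
measurable), then `(g, U⃗) ↦ (g, Φ_g U⃗)` preserves `Haar ⊗ slices` (Fubini). [folklore] -/
theorem measurePreserving_skew {n : ℕ} {Φ : (Site 3 L → SU2) → (Fin (n + 1) → GaugeConfig 3 L SU2) → (Fin (n + 1) → GaugeConfig 3 L SU2)}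
    (hΦm : Measurable (uncurry Φ))
    (hΦ : ∀ g, MeasurePreserving (Φ g) (Measure.pi fun _ : Fin (n + 1) => configMeasure SU2 L) (Measure.pi fun _ : Fin (n + 1) => configMeasure SU2 L)) :
    MeasurePreserving (fun p : (Site 3 L → SU2) × (Fin (n + 1) → GaugeConfig 3 L SU2) => (p.1, Φ p.1 p.2))
      ((gaugeMeasure L).prod (Measure.pi fun _ : Fin (n + 1) => configMeasure SU2 L))
      ((gaugeMeasure L).prod (Measure.pi fun _ : Fin (n + 1) => configMeasure SU2 L)) := by
  haveI := isProbabilityMeasure_gaugeMeasure (L := L)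
  exact (MeasurePreserving.id (gaugeMeasure L)).skew_product hΦm (ae_of_all _ fun g => (hΦ g).map_eq)

/-! ## §2 Domination of a sector event by its translates -/

/-- ★ **One translate inside a sector.**  Let `Φ_g` preserve the slice measure for every seam field `g`, send the event `A` into the event `B`
(`(g, U⃗) ∈ A ⇒ (g, Φ_g U⃗) ∈ B`), and let the sector density satisfy `w_z(U⃗, g) ≤ C · w_z(Φ_g U⃗, g)` on `A` (`C ≥ 0`; this is the cost bound
`e^{ΔS} ≤ C`).  Then `sectorWeight β n z 𝟙_A ≤ C · sectorWeight β n z 𝟙_B`. [cite: Luscher1983, §2] -/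
theorem sectorWeight_indicator_le_of_translate (β : ℝ) (n : ℕ) (z : Fin 3 → Bool)
    {Φ : (Site 3 L → SU2) → (Fin (n + 1) → GaugeConfig 3 L SU2) → (Fin (n + 1) → GaugeConfig 3 L SU2)} (hΦm : Measurable (uncurry Φ))
    (hΦ : ∀ g, MeasurePreserving (Φ g) (Measure.pi fun _ : Fin (n + 1) => configMeasure SU2 L) (Measure.pi fun _ : Fin (n + 1) => configMeasure SU2 L))
    {A B : Set ((Site 3 L → SU2) × (Fin (n + 1) → GaugeConfig 3 L SU2))} (hA : MeasurableSet A) (hB : MeasurableSet B)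
    (hAB : ∀ p ∈ A, (p.1, Φ p.1 p.2) ∈ B) {C : ℝ} (hC : 0 ≤ C)
    (hcost : ∀ p ∈ A, (∏ i : Fin n, transferKernel su2Rep β (p.2 i.castSucc) (p.2 i.succ)) *
        transferKernel su2Rep β (p.2 (Fin.last n)) (gaugeTransform p.1 (twist3 z (p.2 0))) ≤
      C * ((∏ i : Fin n, transferKernel su2Rep β ((Φ p.1 p.2) i.castSucc) ((Φ p.1 p.2) i.succ)) *
        transferKernel su2Rep β ((Φ p.1 p.2) (Fin.last n)) (gaugeTransform p.1 (twist3 z ((Φ p.1 p.2) 0))))) :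
    sectorWeight β n z (fun Us g => A.indicator (fun _ => (1 : ℝ)) (g, Us)) ≤
      C * sectorWeight β n z (fun Us g => B.indicator (fun _ => (1 : ℝ)) (g, Us)) := by
  rw [sectorWeight_indicator_eq_setIntegral β n z hA, sectorWeight_indicator_eq_setIntegral β n z hB]
  exact setIntegral_le_of_map (measurePreserving_skew hΦm hΦ) (seamDensity_nonneg β n z) (integrable_seamDensity_swap β n z) hA hB
    (fun p hp => hAB p hp) hC (fun p hp => hcost p hp)

/-- ★ **A `±` PAIR of translates inside a sector** (the odd part of the cost is free): if `Φ⁺_g, Φ⁻_g` preserve the slice measure, both send `A` into `B`,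
and `2 w_z ≤ C (w_z∘Φ⁺ + w_z∘Φ⁻)` on `A`, then `sectorWeight 𝟙_A ≤ C · sectorWeight 𝟙_B`. [cite: Luscher1983, §2] -/
theorem sectorWeight_indicator_le_of_paired_translates (β : ℝ) (n : ℕ) (z : Fin 3 → Bool)
    {Φp Φm : (Site 3 L → SU2) → (Fin (n + 1) → GaugeConfig 3 L SU2) → (Fin (n + 1) → GaugeConfig 3 L SU2)}
    (hΦpm : Measurable (uncurry Φp)) (hΦmm : Measurable (uncurry Φm))
    (hΦp : ∀ g, MeasurePreserving (Φp g) (Measure.pi fun _ : Fin (n + 1) => configMeasure SU2 L) (Measure.pi fun _ : Fin (n + 1) => configMeasure SU2 L))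
    (hΦm : ∀ g, MeasurePreserving (Φm g) (Measure.pi fun _ : Fin (n + 1) => configMeasure SU2 L) (Measure.pi fun _ : Fin (n + 1) => configMeasure SU2 L))
    {A B : Set ((Site 3 L → SU2) × (Fin (n + 1) → GaugeConfig 3 L SU2))} (hA : MeasurableSet A) (hB : MeasurableSet B)
    (hABp : ∀ p ∈ A, (p.1, Φp p.1 p.2) ∈ B) (hABm : ∀ p ∈ A, (p.1, Φm p.1 p.2) ∈ B) {C : ℝ} (hC : 0 ≤ C)
    (hcost : ∀ p ∈ A, 2 * ((∏ i : Fin n, transferKernel su2Rep β (p.2 i.castSucc) (p.2 i.succ)) *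
        transferKernel su2Rep β (p.2 (Fin.last n)) (gaugeTransform p.1 (twist3 z (p.2 0)))) ≤
      C * ((∏ i : Fin n, transferKernel su2Rep β ((Φp p.1 p.2) i.castSucc) ((Φp p.1 p.2) i.succ)) *
          transferKernel su2Rep β ((Φp p.1 p.2) (Fin.last n)) (gaugeTransform p.1 (twist3 z ((Φp p.1 p.2) 0))) +
        (∏ i : Fin n, transferKernel su2Rep β ((Φm p.1 p.2) i.castSucc) ((Φm p.1 p.2) i.succ)) *
          transferKernel su2Rep β ((Φm p.1 p.2) (Fin.last n)) (gaugeTransform p.1 (twist3 z ((Φm p.1 p.2) 0))))) :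
    sectorWeight β n z (fun Us g => A.indicator (fun _ => (1 : ℝ)) (g, Us)) ≤
      C * sectorWeight β n z (fun Us g => B.indicator (fun _ => (1 : ℝ)) (g, Us)) := by
  rw [sectorWeight_indicator_eq_setIntegral β n z hA, sectorWeight_indicator_eq_setIntegral β n z hB]
  exact setIntegral_le_of_paired_maps (measurePreserving_skew hΦpm hΦp) (measurePreserving_skew hΦmm hΦm) (seamDensity_nonneg β n z)
    (integrable_seamDensity_swap β n z) hA hB (fun p hp => hABp p hp) (fun p hp => hABm p hp) hC (fun p hp => hcost p hp)

/-! ## §3 Translate counting -/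

/-- ★ **Translate counting inside a sector**: if for each `k < K` the event `A` is dominated, `sectorWeight 𝟙_A ≤ C · sectorWeight 𝟙_{B k}`, by pairwise
disjoint measurable events `B k`, then `K · sectorWeight 𝟙_A ≤ C · sectorWeight 1` — the shape of the periodic-sector core estimate with `q₀ = C/K`.
[cite: MadrasSokal1988, §2] [cite: Luscher1983, §2] -/
theorem mul_sectorWeight_indicator_le_of_disjoint (β : ℝ) (n : ℕ) (z : Fin 3 → Bool)
    {A : Set ((Site 3 L → SU2) × (Fin (n + 1) → GaugeConfig 3 L SU2))} (hA : MeasurableSet A) {K : ℕ}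
    {B : ℕ → Set ((Site 3 L → SU2) × (Fin (n + 1) → GaugeConfig 3 L SU2))} (hB : ∀ k, MeasurableSet (B k))
    (hdisj : Pairwise (Function.onFun Disjoint B)) {C : ℝ} (hC : 0 ≤ C)
    (hdom : ∀ k, k < K → sectorWeight β n z (fun Us g => A.indicator (fun _ => (1 : ℝ)) (g, Us)) ≤
      C * sectorWeight β n z (fun Us g => (B k).indicator (fun _ => (1 : ℝ)) (g, Us))) :
    (K : ℝ) * sectorWeight β n z (fun Us g => A.indicator (fun _ => (1 : ℝ)) (g, Us)) ≤ C * sectorWeight (L := L) β n z (fun _ _ => (1 : ℝ)) := by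
  rw [sectorWeight_indicator_eq_setIntegral β n z hA, sectorWeight_one_eq_integral_swap]
  refine mul_setIntegral_le_of_disjoint (seamDensity_nonneg β n z) (integrable_seamDensity_swap β n z) hB hdisj hC fun k hk => ?_
  have h := hdom k hk
  rwa [sectorWeight_indicator_eq_setIntegral β n z hA, sectorWeight_indicator_eq_setIntegral β n z (hB k)] at h

/-- **The stub's shape**: `K ≥ 1` dominations with constant `C` into pairwise disjoint events give
`sectorWeight 𝟙_A ≤ (C/K) · sectorWeight 1`. [cite: Luscher1983, §2] -/
theorem sectorWeight_indicator_le_div_of_disjoint (β : ℝ) (n : ℕ) (z : Fin 3 → Bool)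
    {A : Set ((Site 3 L → SU2) × (Fin (n + 1) → GaugeConfig 3 L SU2))} (hA : MeasurableSet A) {K : ℕ} (hK : 1 ≤ K)
    {B : ℕ → Set ((Site 3 L → SU2) × (Fin (n + 1) → GaugeConfig 3 L SU2))} (hB : ∀ k, MeasurableSet (B k))
    (hdisj : Pairwise (Function.onFun Disjoint B)) {C : ℝ} (hC : 0 ≤ C)
    (hdom : ∀ k, k < K → sectorWeight β n z (fun Us g => A.indicator (fun _ => (1 : ℝ)) (g, Us)) ≤
      C * sectorWeight β n z (fun Us g => (B k).indicator (fun _ => (1 : ℝ)) (g, Us))) :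
    sectorWeight β n z (fun Us g => A.indicator (fun _ => (1 : ℝ)) (g, Us)) ≤ C / K * sectorWeight (L := L) β n z (fun _ _ => (1 : ℝ)) := by
  have h := mul_sectorWeight_indicator_le_of_disjoint (L := L) β n z hA hB hdisj hC hdom
  have hK0 : (0 : ℝ) < K := by exact_mod_cast hK
  rw [div_mul_eq_mul_div, le_div_iff₀ hK0, mul_comm]
  exact h

end Summit.QuantumFields.YangMills.Theorems.FemtoTransferGap.TT

end
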